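import Literature.Probability.RandomPlanarGeometry.SLETraceEight
import Literature.Probability.RandomPlanarGeometry.SLERestrictionLemmas
import Literature.Probability.RandomPlanarGeometry.SLEBoundaryHittingProofs
import Literature.Probability.RandomPlanarGeometry.SLETwoPointFlowProofs
import HarnessLib

/-!
# The boundary extension of `gₜ⁻¹` for a Loewner chain generated by a simple curve

Trunk T-STOCH, deterministic Loewner theory. Let the chordal Loewner chain of the continuous
driving function `W` be generated by the curve `γ`. The tree proves that `fₜ = gₜ⁻¹`
(`Loewner.loewnerInv`) has the limit `γ(t)` at `Wₜ` within `ℍₒ` (`LoewnerTraceLimit`) and, by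
the same Carathéodory argument, a limit at every point of the closed half-plane, so that
`extendFrom ℍₒ fₜ` is continuous on `ℍ̄ₒ` (`SLETraceEight`:
`IsGeneratedByCurve.exists_tendsto_loewnerInv`, `continuousOn_extendFrom_loewnerInv`). This file
NAMES that extension `f̄ₜ` (`Loewner.bdryInv`) and records its elementary properties — the
vocabulary of the proof of [LSW] Lemma 6.2 (G. F. Lawler, O. Schramm, W. Werner, *Conformal
restriction: the chordal case*, J. Amer. Math. Soc. **16** (2003), arXiv:math/0209343,
Lemma 6.2: "the limit `w := lim_{s ↗ 1} g_T ∘ β(s)` exists … Moreover, since `β(1) = z₀`, we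
must have `w = W`"):

* `Loewner.bdryInv W t` — the extension `f̄ₜ = extendFrom ℍₒ fₜ`; continuous on `{im ≥ 0}`,
  equal to `fₜ` on `ℍₒ`, `f̄ₜ(Wₜ) = γ(t)` (all from `SLETraceEight`); at a real point its value
  lies on `∂Hₜ ⊆ γ[0,t] ∪ ℝ` (`bdryInv_ofReal_mem_frontier`), and `v = gₜ(f̄ₜ v)` whenever `gₜ`
  is continuous at `f̄ₜ v` (`ofReal_eq_map_bdryInv`);
* for a SIMPLE generating curve and `W 0 = 0`: no real point other than `0` is swallowed
  (`swallowingTime_ofReal_eq_top_of_isSimpleTrace`), `gₜ` is real, continuous and increasing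
  on `ℝ ∖ {0}` with `gₜ x > Wₜ` for `x > 0`, `gₜ x < Wₜ` for `x < 0`, `f̄ₜ (gₜ x) = x`
  (`bdryInv_map_ofReal`), and consequently every real `v` is either such a value `gₜ x`,
  `x ≠ 0` (and then `f̄ₜ v = x`), or has `f̄ₜ v ∈ γ[0, t]` (`bdryInv_ofReal_dichotomy`);
* `norm_map_sub_self_le_of_mem_domain` — a uniform displacement bound `|gₜ z - z| = O(osc W + √t)`
  on `Hₜ`, and `IsGeneratedByCurve.eq_driving_of_bdryInv_eq` — **the tip `γ(t)` is the value of
  `f̄ₜ` at `Wₜ` only** (the quoted step of [LSW]).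

## References

* G. F. Lawler, *Conformally Invariant Processes in the Plane*, AMS (2005), §4.1, §4.4
  (Prop. 4.31, Rem. 4.32).
* G. F. Lawler, O. Schramm, W. Werner, *Conformal restriction: the chordal case* (2003),
  Lemma 6.2. [LawlerSchrammWerner2003Restriction]
-/

noncomputable section

open Set Filter Topology Metric Complex Bornology
open UpperHalfPlane (upperHalfPlaneSet isOpen_upperHalfPlaneSet)
open scoped NNReal

namespace Literature.Probability.RandomPlanarGeometry

namespace Loewner

variable {W : ℝ≥0 → ℝ} {γ : ℝ≥0 → ℂ}

/-! ### The boundary extension `f̄ₜ` -/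

/-- **The boundary extension `f̄ₜ` of `fₜ = gₜ⁻¹` to the closed half-plane**: the limit of `fₜ`
within `ℍₒ` wherever it exists (`extendFrom`); for a chain generated by a curve it exists at
every point of `{im ≥ 0}` and `f̄ₜ` is continuous there. Lawler (2005), Prop. 4.31 / Rem. 4.32
("`gₜ⁻¹` extends continuously to `ℍ̄`"). [cite: Lawler2005, Rem. 4.32] -/
def bdryInv (W : ℝ≥0 → ℝ) (t : ℝ≥0) : ℂ → ℂ :=
  extendFrom upperHalfPlaneSet (loewnerInv W t)

/-- `f̄ₜ` is the limit of `fₜ` within `ℍₒ` at every point of the closed half-plane.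
[cite: Lawler2005, Rem. 4.32] -/
theorem IsGeneratedByCurve.tendsto_bdryInv (hγ : IsGeneratedByCurve W γ) (hW : Continuous W)
    (t : ℝ≥0) {z : ℂ} (hz : 0 ≤ z.im) :
    Tendsto (loewnerInv W t) (𝓝[upperHalfPlaneSet] z) (𝓝 (bdryInv W t z)) :=
  tendsto_extendFrom (hγ.exists_tendsto_loewnerInv hW t (mem_closure_upperHalfPlaneSet_iff.2 hz))

/-- **`f̄ₜ` is continuous on the closed half-plane** (`continuousOn_extendFrom_loewnerInv`).
[cite: Lawler2005, Rem. 4.32] -/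
theorem IsGeneratedByCurve.continuousOn_bdryInv (hγ : IsGeneratedByCurve W γ) (hW : Continuous W)
    (t : ℝ≥0) : ContinuousOn (bdryInv W t) {z : ℂ | 0 ≤ z.im} := by
  have h := hγ.continuousOn_extendFrom_loewnerInv hW t
  rwa [show closure upperHalfPlaneSet = {z : ℂ | 0 ≤ z.im} from closure_setOf_lt_im 0] at h

/-- On `ℍₒ`, `f̄ₜ = fₜ` (`extendFrom_loewnerInv_eq`). [folklore] -/
theorem bdryInv_eq_of_mem (hW : Continuous W) (t : ℝ≥0) {z : ℂ} (hz : z ∈ upperHalfPlaneSet) :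
    bdryInv W t z = loewnerInv W t z :=
  extendFrom_loewnerInv_eq hW t hz

/-- On `ℍₒ`, `f̄ₜ` takes values in `Hₜ`. [folklore] -/
theorem bdryInv_mem_domain (hW : Continuous W) (t : ℝ≥0) {z : ℂ} (hz : z ∈ upperHalfPlaneSet) :
    bdryInv W t z ∈ domain W t := by
  rw [bdryInv_eq_of_mem hW t hz]
  exact (bijOn_invFunOn_map hW t).mapsTo hz

/-- On `ℍₒ`, `gₜ ∘ f̄ₜ = id`. [folklore] -/
theorem map_bdryInv (hW : Continuous W) (t : ℝ≥0) {z : ℂ} (hz : z ∈ upperHalfPlaneSet) :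
    map W t (bdryInv W t z) = z := by
  rw [bdryInv_eq_of_mem hW t hz]
  exact (bijOn_map hW t).invOn_invFunOn.2 hz

/-- On `Hₜ`, `f̄ₜ ∘ gₜ = id`. [folklore] -/
theorem bdryInv_map (hW : Continuous W) (t : ℝ≥0) {z : ℂ} (hz : z ∈ domain W t) :
    bdryInv W t (map W t z) = z := by
  rw [bdryInv_eq_of_mem hW t (mapsTo_map hW t hz)]
  exact (bijOn_map hW t).invOn_invFunOn.1 hz

/-- **`f̄ₜ(Wₜ) = γ(t)`**: the value at the driving point is the tip
(`extendFrom_loewnerInv_driving`). [cite: Lawler2005, Prop. 4.31] -/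
theorem IsGeneratedByCurve.bdryInv_driving (hγ : IsGeneratedByCurve W γ) (hW : Continuous W)
    (t : ℝ≥0) : bdryInv W t (W t) = γ t :=
  hγ.extendFrom_loewnerInv_driving hW t

/-- `f̄ₜ` maps the closed half-plane into the closure of `Hₜ`. [folklore] -/
theorem IsGeneratedByCurve.bdryInv_mem_closure (hγ : IsGeneratedByCurve W γ) (hW : Continuous W)
    (t : ℝ≥0) {z : ℂ} (hz : 0 ≤ z.im) : bdryInv W t z ∈ closure (domain W t) := by
  have hcl : z ∈ closure upperHalfPlaneSet := by
    rw [show closure upperHalfPlaneSet = {z : ℂ | 0 ≤ z.im} from closure_setOf_lt_im 0]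
    exact hz
  haveI : (𝓝[upperHalfPlaneSet] z).NeBot := mem_closure_iff_nhdsWithin_neBot.1 hcl
  refine mem_closure_of_tendsto (hγ.tendsto_bdryInv hW t hz) ?_
  filter_upwards [self_mem_nhdsWithin] with w hw
  exact (bijOn_invFunOn_map hW t).mapsTo hw

/-- **At a real point, `v = gₜ(f̄ₜ v)` as soon as `gₜ` is continuous at `f̄ₜ v`** (then
`w = gₜ(fₜ w) → gₜ(f̄ₜ v)` as `w → v`). [folklore] -/
theorem IsGeneratedByCurve.ofReal_eq_map_bdryInv (hγ : IsGeneratedByCurve W γ) (hW : Continuous W)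
    (t : ℝ≥0) (v : ℝ) (hc : ContinuousAt (map W t) (bdryInv W t v)) :
    (v : ℂ) = map W t (bdryInv W t v) := by
  haveI := neBot_nhdsWithin_ofReal v
  have h1 : Tendsto (fun w ↦ map W t (loewnerInv W t w))
      (𝓝[upperHalfPlaneSet] (v : ℂ)) (𝓝 (map W t (bdryInv W t v))) :=
    hc.tendsto.comp (hγ.tendsto_bdryInv hW t (by simp))
  have h2 : Tendsto (fun w ↦ map W t (loewnerInv W t w))
      (𝓝[upperHalfPlaneSet] (v : ℂ)) (𝓝 (v : ℂ)) := by
    refine (tendsto_nhdsWithin_of_tendsto_nhds tendsto_id).congr' ?_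
    filter_upwards [self_mem_nhdsWithin] with w hw
    exact ((bijOn_map hW t).invOn_invFunOn.2 hw).symm
  exact tendsto_nhds_unique h2 h1

/-- **The value of `f̄ₜ` at a real point lies on `∂Hₜ`** (it is in the closure of `Hₜ`; if it
were in the open set `Hₜ`, `gₜ` would be continuous there and `v = gₜ(f̄ₜ v) ∈ ℍₒ`).
[folklore] -/
theorem IsGeneratedByCurve.bdryInv_ofReal_mem_frontier (hγ : IsGeneratedByCurve W γ)
    (hW : Continuous W) (t : ℝ≥0) (v : ℝ) : bdryInv W t v ∈ frontier (domain W t) := by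
  rw [frontier, (isOpen_domain hW t).interior_eq]
  refine ⟨hγ.bdryInv_mem_closure hW t (by simp), fun hmem ↦ ?_⟩
  have hc : ContinuousAt (map W t) (bdryInv W t v) :=
    continuousAt_map hW ((mem_domain_iff W t _).1 hmem).2
  have heq := hγ.ofReal_eq_map_bdryInv hW t v hc
  have him : 0 < ((v : ℝ) : ℂ).im := by
    rw [heq]
    exact mapsTo_map hW t hmem
  simp at him

/-- Hence `f̄ₜ v ∈ γ[0, t] ∪ ℝ` for real `v`. [folklore] -/
theorem IsGeneratedByCurve.bdryInv_ofReal_mem (hγ : IsGeneratedByCurve W γ) (hW : Continuous W)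
    (t : ℝ≥0) (v : ℝ) : bdryInv W t v ∈ γ '' Icc 0 t ∪ {z : ℂ | z.im = 0} :=
  hγ.frontier_domain_subset hW t (hγ.bdryInv_ofReal_mem_frontier hW t v)

/-! ### Real points under the flow: monotonicity in the starting point -/

/-- The Loewner map is increasing on the real points to the right of `W 0` (as long as they are
not swallowed): `W 0 < x < y ⇒ re gₜ x < re gₜ y` (`IsSolution.re_lt_re`). [folklore] -/
theorem map_ofReal_re_lt_of_lt (hW : Continuous W) {x y : ℝ} (hx : W 0 < x) (hxy : x < y) {t : ℝ≥0}
    (htx : (t : WithTop ℝ≥0) < swallowingTime W x) (hty : (t : WithTop ℝ≥0) < swallowingTime W y) :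
    (map W t x).re < (map W t y).re := by
  obtain ⟨g, hg⟩ := exists_isSolution_swallowingTime_holds hW (ne_driving_of_lt_swallowingTime htx)
  obtain ⟨g', hg'⟩ := exists_isSolution_swallowingTime_holds hW (ne_driving_of_lt_swallowingTime hty)
  rw [map_eq_of_isSolution hW hg htx, map_eq_of_isSolution hW hg' hty]
  exact hg.re_lt_re hW hg' hx hxy t.coe_nonneg (by simpa using htx) (by simpa using hty)

/-- The same to the left of `W 0`: `x < y < W 0 ⇒ re gₜ x < re gₜ y` (by the reflection
`(W, z) ↦ (-W, -z̄)`, `map_neg_conj`). [folklore] -/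
theorem map_ofReal_re_lt_of_lt_of_neg (hW : Continuous W) {x y : ℝ} (hy : y < W 0) (hxy : x < y)
    {t : ℝ≥0} (htx : (t : WithTop ℝ≥0) < swallowingTime W x)
    (hty : (t : WithTop ℝ≥0) < swallowingTime W y) :
    (map W t x).re < (map W t y).re := by
  have hW' : Continuous fun s ↦ -W s := hW.neg
  have htx' : (t : WithTop ℝ≥0) < swallowingTime (fun s ↦ -W s) ((-x : ℝ) : ℂ) := by
    rwa [swallowingTime_neg_ofReal]
  have hty' : (t : WithTop ℝ≥0) < swallowingTime (fun s ↦ -W s) ((-y : ℝ) : ℂ) := by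
    rwa [swallowingTime_neg_ofReal]
  have h := map_ofReal_re_lt_of_lt hW' (show -W 0 < -y by linarith) (neg_lt_neg hxy) hty' htx'
  have ex : ((-x : ℝ) : ℂ) = -(starRingEnd ℂ (x : ℂ)) := by simp
  have ey : ((-y : ℝ) : ℂ) = -(starRingEnd ℂ (y : ℂ)) := by simp
  rw [ex, ey, map_neg_conj hW htx, map_neg_conj hW hty] at h
  simp only [neg_re, conj_re] at h
  linarith

/-! ### Real points under the flow: values -/

/-- `gₜ x` is real for a real point `x` not yet swallowed. [folklore] -/
theorem map_ofReal_im (hW : Continuous W) {x : ℝ} {t : ℝ≥0}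
    (ht : (t : WithTop ℝ≥0) < swallowingTime W x) : (map W t x).im = 0 := by
  obtain ⟨g, hg⟩ := exists_isSolution_swallowingTime_holds hW (ne_driving_of_lt_swallowingTime ht)
  rw [map_eq_of_isSolution hW hg ht]
  exact IsSolution.im_eq_zero_holds hg (Complex.ofReal_im x) t t.coe_nonneg (by simpa using ht)

/-- `gₜ x` as a real number, for a real point `x` not yet swallowed. [folklore] -/
theorem map_ofReal_eq (hW : Continuous W) {x : ℝ} {t : ℝ≥0}
    (ht : (t : WithTop ℝ≥0) < swallowingTime W x) : map W t x = (((map W t x).re : ℝ) : ℂ) := by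
  conv_lhs => rw [← Complex.re_add_im (map W t x), map_ofReal_im hW ht]
  simp

/-- `gₜ x > Wₜ` for a real point `x > W 0` not yet swallowed (`realFlow_pos`). [folklore] -/
theorem driving_lt_map_ofReal_re (hW : Continuous W) {x : ℝ} (hx : W 0 < x) {t : ℝ≥0}
    (ht : (t : WithTop ℝ≥0) < swallowingTime W x) : W t < (map W t x).re := by
  have h := realFlow_pos hW hx ht
  rw [realFlow_apply] at h
  linarith

/-- `gₜ x < Wₜ` for a real point `x < W 0` not yet swallowed (`realFlow_neg`). [folklore] -/
theorem map_ofReal_re_lt_driving (hW : Continuous W) {x : ℝ} (hx : x < W 0) {t : ℝ≥0}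
    (ht : (t : WithTop ℝ≥0) < swallowingTime W x) : (map W t x).re < W t := by
  have h := realFlow_neg hW hx ht
  rw [realFlow_apply] at h
  linarith

/-! ### Real points for a simple generating curve from the origin -/

section Simple

/-- **For a chain from `0` generated by a simple curve, no real point other than `0` is ever
swallowed** (swallowing of real points = hitting of real rays, Lawler (2005) Rem. 6.6, and a
simple trace in `ℍₒ ∪ {0}` hits no real ray). The deterministic form of
`swallowingTime_ofReal_eq_top` (`SLERestrictionLemmas`, stated there for SLE with the swallowing
fact as a hypothesis). [cite: Lawler2005, Rem. 6.6] -/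
theorem swallowingTime_ofReal_eq_top_of_isSimpleTrace (hW : Continuous W) (hW0 : W 0 = 0)
    (hγ : IsGeneratedByCurve W γ) (hs : IsSimpleTrace γ) {x : ℝ} (hx : x ≠ 0) :
    swallowingTime W x = ⊤ := by
  rw [swallowingTime_ofReal_eq_firstHit_of_ne hW hW0 hγ hx]
  refine firstHit_realRay_eq_top hs ?_ hx
  rw [hγ.apply_zero, hW0, Complex.ofReal_zero]

variable (hW : Continuous W) (hW0 : W 0 = 0) (hγ : IsGeneratedByCurve W γ) (hs : IsSimpleTrace γ)
include hW hW0 hγ hs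

/-- Real points `x ≠ 0` flow for all times. [folklore] -/
theorem lt_swallowingTime_ofReal_of_isSimpleTrace {x : ℝ} (hx : x ≠ 0) (t : ℝ≥0) :
    (t : WithTop ℝ≥0) < swallowingTime W x := by
  rw [swallowingTime_ofReal_eq_top_of_isSimpleTrace hW hW0 hγ hs hx]
  exact WithTop.coe_lt_top t

/-- `gₜ` is continuous at every real `x ≠ 0`. [folklore] -/
theorem continuousAt_map_ofReal_of_isSimpleTrace {x : ℝ} (hx : x ≠ 0) (t : ℝ≥0) :
    ContinuousAt (map W t) x :=
  continuousAt_map hW (lt_swallowingTime_ofReal_of_isSimpleTrace hW hW0 hγ hs hx t)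

/-- `gₜ x` is real for real `x ≠ 0`. [folklore] -/
theorem map_ofReal_im_of_isSimpleTrace {x : ℝ} (hx : x ≠ 0) (t : ℝ≥0) : (map W t x).im = 0 :=
  map_ofReal_im hW (lt_swallowingTime_ofReal_of_isSimpleTrace hW hW0 hγ hs hx t)

/-- `gₜ x` as a real number, for real `x ≠ 0`. [folklore] -/
theorem map_ofReal_eq_of_isSimpleTrace {x : ℝ} (hx : x ≠ 0) (t : ℝ≥0) :
    map W t x = (((map W t x).re : ℝ) : ℂ) :=
  map_ofReal_eq hW (lt_swallowingTime_ofReal_of_isSimpleTrace hW hW0 hγ hs hx t)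

/-- `gₜ x > Wₜ` for `x > 0`. [folklore] -/
theorem driving_lt_map_ofReal_re_of_isSimpleTrace {x : ℝ} (hx : 0 < x) (t : ℝ≥0) :
    W t < (map W t x).re :=
  driving_lt_map_ofReal_re hW (by rwa [hW0])
    (lt_swallowingTime_ofReal_of_isSimpleTrace hW hW0 hγ hs hx.ne' t)

/-- `gₜ x < Wₜ` for `x < 0`. [folklore] -/
theorem map_ofReal_re_lt_driving_of_isSimpleTrace {x : ℝ} (hx : x < 0) (t : ℝ≥0) :
    (map W t x).re < W t :=
  map_ofReal_re_lt_driving hW (by rwa [hW0])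
    (lt_swallowingTime_ofReal_of_isSimpleTrace hW hW0 hγ hs hx.ne t)

/-- `gₜ x ≠ Wₜ` for real `x ≠ 0`. [folklore] -/
theorem map_ofReal_re_ne_driving_of_isSimpleTrace {x : ℝ} (hx : x ≠ 0) (t : ℝ≥0) :
    (map W t x).re ≠ W t := by
  rcases lt_or_gt_of_ne hx with h | h
  · exact (map_ofReal_re_lt_driving_of_isSimpleTrace hW hW0 hγ hs h t).ne
  · exact (driving_lt_map_ofReal_re_of_isSimpleTrace hW hW0 hγ hs h t).ne'

/-- `gₜ` is increasing on the positive reals. [folklore] -/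
theorem map_ofReal_re_strictMonoOn_pos_of_isSimpleTrace (t : ℝ≥0) :
    StrictMonoOn (fun x : ℝ ↦ (map W t x).re) (Ioi 0) := fun x hx y _ hxy ↦
  map_ofReal_re_lt_of_lt hW (by rw [hW0]; exact hx) hxy
    (lt_swallowingTime_ofReal_of_isSimpleTrace hW hW0 hγ hs (ne_of_gt hx) t)
    (lt_swallowingTime_ofReal_of_isSimpleTrace hW hW0 hγ hs (ne_of_gt (lt_trans hx hxy)) t)

/-- `gₜ` is increasing on the negative reals. [folklore] -/
theorem map_ofReal_re_strictMonoOn_neg_of_isSimpleTrace (t : ℝ≥0) :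
    StrictMonoOn (fun x : ℝ ↦ (map W t x).re) (Iio 0) := fun x hx y hy hxy ↦
  map_ofReal_re_lt_of_lt_of_neg hW (by rw [hW0]; exact hy) hxy
    (lt_swallowingTime_ofReal_of_isSimpleTrace hW hW0 hγ hs (ne_of_lt (lt_trans hxy hy)) t)
    (lt_swallowingTime_ofReal_of_isSimpleTrace hW hW0 hγ hs (ne_of_lt hy) t)

omit hW in
/-- Real points of `γ[0, t]`: only the origin `γ 0 = 0`. [folklore] -/
theorem eq_zero_of_mem_image_of_im_eq_zero_of_isSimpleTrace {t : ℝ≥0} {z : ℂ} (hz : z ∈ γ '' Icc 0 t)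
    (him : z.im = 0) : z = 0 := by
  obtain ⟨s, hs', rfl⟩ := hz
  rcases (show (0 : ℝ≥0) ≤ s from bot_le).eq_or_lt with h | h
  · rw [← h, hγ.apply_zero, hW0, Complex.ofReal_zero]
  · exact absurd him (hs.2 s h).ne'

omit hW in
/-- A real `x ≠ 0` is off the curve `γ[0, t]`. [folklore] -/
theorem ofReal_notMem_image_of_isSimpleTrace {x : ℝ} (hx : x ≠ 0) (t : ℝ≥0) : (x : ℂ) ∉ γ '' Icc 0 t := fun h ↦
  hx (by simpa using eq_zero_of_mem_image_of_im_eq_zero_of_isSimpleTrace hW0 hγ hs h (Complex.ofReal_im x))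

omit hW in
/-- Points of `ℍₒ` near a real `x ≠ 0` lie in `Hₜ`. [folklore] -/
theorem eventually_mem_domain_ofReal_of_isSimpleTrace {x : ℝ} (hx : x ≠ 0) (t : ℝ≥0) :
    ∀ᶠ z in 𝓝 (x : ℂ), z ∈ upperHalfPlaneSet → z ∈ domain W t := by
  have hcl : IsClosed (γ '' Icc 0 t) := (hγ.isCompact_image t).isClosed
  filter_upwards [hcl.isOpen_compl.mem_nhds (ofReal_notMem_image_of_isSimpleTrace hW0 hγ hs hx t)] with z hz hzH
  refine ⟨hzH, fun hhull ↦ hz ?_⟩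
  rw [hγ.hull_eq_image hs t] at hhull
  exact image_mono Ioc_subset_Icc_self hhull

/-- **`f̄ₜ (gₜ x) = x` for real `x ≠ 0`**: approach `gₜ x` along `gₜ (x + i/n)`, on which
`fₜ ∘ gₜ = id`. [folklore] -/
theorem bdryInv_map_ofReal {x : ℝ} (hx : x ≠ 0) (t : ℝ≥0) : bdryInv W t (map W t x) = x := by
  set z : ℕ → ℂ := fun n ↦ (x : ℂ) + I * ((1 : ℝ) / (n + 1) : ℝ) with hzdef
  have hzim : ∀ n, (z n).im = 1 / (n + 1) := fun n ↦ by
    simp only [hzdef, add_im, ofReal_im, mul_im, I_re, I_im, ofReal_re, zero_mul, one_mul, zero_add]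
  have hzH : ∀ n, z n ∈ upperHalfPlaneSet := fun n ↦ by
    show 0 < (z n).im
    rw [hzim]
    positivity
  have hzlim : Tendsto z atTop (𝓝 (x : ℂ)) := by
    have h : Tendsto (fun n : ℕ ↦ ((1 : ℝ) / (n + 1) : ℝ)) atTop (𝓝 0) :=
      tendsto_one_div_add_atTop_nhds_zero_nat
    have h2 : Tendsto (fun n : ℕ ↦ (x : ℂ) + I * (((1 : ℝ) / (n + 1) : ℝ) : ℂ)) atTop
        (𝓝 ((x : ℂ) + I * ((0 : ℝ) : ℂ))) :=
      tendsto_const_nhds.add (tendsto_const_nhds.mul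
        (Complex.continuous_ofReal.tendsto' _ _ rfl |>.comp h))
    simpa [hzdef] using h2
  have hzdom : ∀ᶠ n in atTop, z n ∈ domain W t :=
    (hzlim.eventually (eventually_mem_domain_ofReal_of_isSimpleTrace hW0 hγ hs hx t)).mono
      fun n hn ↦ hn (hzH n)
  -- `gₜ (z n) → gₜ x` within `ℍₒ`
  have hmap : Tendsto (fun n ↦ map W t (z n)) atTop (𝓝[upperHalfPlaneSet] (map W t x)) := by
    refine tendsto_nhdsWithin_iff.2 ⟨?_, hzdom.mono fun n hn ↦ mapsTo_map hW t hn⟩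
    exact ((continuousAt_map_ofReal_of_isSimpleTrace hW hW0 hγ hs hx t).tendsto).comp hzlim
  have him0 : 0 ≤ (map W t x).im := (map_ofReal_im_of_isSimpleTrace hW hW0 hγ hs hx t).ge
  have h1 : Tendsto (fun n ↦ loewnerInv W t (map W t (z n))) atTop
      (𝓝 (bdryInv W t (map W t x))) := (hγ.tendsto_bdryInv hW t him0).comp hmap
  have h2 : Tendsto (fun n ↦ loewnerInv W t (map W t (z n))) atTop
      (𝓝 (x : ℂ)) := by
    refine hzlim.congr' ?_
    filter_upwards [hzdom] with n hn
    exact ((bijOn_map hW t).invOn_invFunOn.1 hn).symm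
  exact tendsto_nhds_unique h1 h2

/-- **Dichotomy for the boundary values**: for real `v`, either `f̄ₜ v` lies on the curve
`γ[0, t]`, or `v = gₜ x` for a real `x ≠ 0` and `f̄ₜ v = x`. [folklore] -/
theorem bdryInv_ofReal_dichotomy (t : ℝ≥0) (v : ℝ) :
    bdryInv W t v ∈ γ '' Icc 0 t ∨
      ∃ x : ℝ, x ≠ 0 ∧ map W t x = v ∧ bdryInv W t v = x := by
  rcases hγ.bdryInv_ofReal_mem hW t v with h | him
  · exact Or.inl h
  · set x : ℝ := (bdryInv W t v).re with hxdef
    have hval : bdryInv W t v = x := by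
      rw [← Complex.re_add_im (bdryInv W t v), show (bdryInv W t v).im = 0 from him]
      simp [hxdef]
    by_cases hx : x = 0
    · left
      refine ⟨0, ⟨le_rfl, bot_le⟩, ?_⟩
      rw [hγ.apply_zero, hW0, hval, hx]
    · right
      refine ⟨x, hx, ?_, hval⟩
      have h := hγ.ofReal_eq_map_bdryInv hW t v
        (by rw [hval]; exact continuousAt_map_ofReal_of_isSimpleTrace hW hW0 hγ hs hx t)
      rw [hval] at h
      exact h.symm

/-! ### Closed hulls of a simple curve -/

/-- The closed hull of a chain from `0` generated by a simple curve is contained in `γ[0, t]`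
(its part in `ℍₒ` is `γ(0, t]`, and the only swallowed real point is `0 = γ 0`). The
deterministic form of `closedHull_subset_image` (`SLERestrictionLemmas`, for SLE). [folklore] -/
theorem closedHull_subset_image_of_isSimpleTrace (t : ℝ≥0) : closedHull W t ⊆ γ '' Icc 0 t := by
  intro z hz
  rcases mem_closedHull_iff.1 hz with h | ⟨him, hT⟩
  · rw [hγ.hull_eq_image hs t] at h
    exact image_mono Ioc_subset_Icc_self h
  · have hz' : z = ((z.re : ℝ) : ℂ) := by
      rw [← Complex.re_add_im z, him]
      simp
    by_cases hre : z.re = 0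
    · refine ⟨0, ⟨le_rfl, bot_le⟩, ?_⟩
      rw [hγ.apply_zero, hW0, hz', hre]
    · exfalso
      have := lt_swallowingTime_ofReal_of_isSimpleTrace hW hW0 hγ hs hre t
      rw [← hz'] at this
      exact (lt_irrefl _ (this.trans_le hT))

omit hW hW0 in
/-- Conversely `γ[0, t]` lies in the closed hull. [folklore] -/
theorem image_subset_closedHull_of_isSimpleTrace (t : ℝ≥0) : γ '' Icc 0 t ⊆ closedHull W t := by
  rintro _ ⟨s', hs', rfl⟩
  rcases (show (0 : ℝ≥0) ≤ s' from bot_le).eq_or_lt with h | h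
  · rw [← h, hγ.apply_zero]
    exact ⟨by simp, (swallowingTime_driving_le W).trans bot_le⟩
  · refine hull_subset_closedHull W t ?_
    rw [hγ.hull_eq_image hs t]
    exact ⟨s', ⟨h, hs'.2⟩, rfl⟩

end Simple

/-! ### A uniform displacement bound for the Loewner map -/

/-- **Uniform displacement bound**: if `|W u - c| ≤ M` on `[0, t]` (`t > 0`), then
`|gₜ z - z| ≤ 2M + 13√t` for EVERY `z ∈ Hₜ`. Far from `c` this is the far-field bound
`lt_swallowingTime_of_far` (with `δ = 2√t`); near `c`, the image `w = gₜ z` cannot be far from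
`c`, for otherwise the far-field bound for the BACKWARD map (`norm_invFunOn_map_sub_self_le`)
would put `z = fₜ w` far from `c` as well. (A weak form, sufficient for limits, of the uniform
bound of Lawler (2005), Ch. 4 §4.1, obtained there with Lemma 4.13 on the size of the hulls.)
[cite: Lawler2005, Ch. 4 §4.1 (Lemma 4.13)] -/
theorem norm_map_sub_self_le_of_mem_domain (hW : Continuous W) {t : ℝ≥0} {c : ℂ}
    {M : ℝ} (hM : ∀ u ∈ Icc (0 : ℝ) t, ‖(W u.toNNReal : ℂ) - c‖ ≤ M) {z : ℂ}
    (hz : z ∈ domain W t) : ‖map W t z - z‖ ≤ 2 * M + 13 * Real.sqrt t := by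
  have hM0 : 0 ≤ M := (norm_nonneg _).trans (hM 0 ⟨le_rfl, t.coe_nonneg⟩)
  rcases (show (0 : ℝ≥0) ≤ t from bot_le).eq_or_lt with ht | ht
  · -- `t = 0`: `g₀ = id`
    rw [← ht, map_zero_apply hW (ne_driving_of_lt_swallowingTime ((mem_domain_iff W _ _).1 (ht ▸ hz)).2)]
    simp only [sub_self, norm_zero, NNReal.coe_zero, Real.sqrt_zero, mul_zero, add_zero]
    positivity
  have ht' : (0 : ℝ) < t := ht
  set δ : ℝ := 2 * Real.sqrt t with hδdef
  have hsq : 0 < Real.sqrt t := Real.sqrt_pos.2 ht'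
  have hδ : 0 < δ := by positivity
  have hδt : 4 * (t : ℝ) ≤ δ ^ 2 := by
    rw [hδdef, mul_pow, Real.sq_sqrt ht'.le]
    linarith
  have hquot : 2 / δ * t = Real.sqrt t := by
    rw [hδdef, div_mul_eq_mul_div, div_eq_iff (by positivity)]
    nlinarith [Real.mul_self_sqrt ht'.le]
  by_cases hfar : M + 2 * δ ≤ ‖z - c‖
  · have h := ((lt_swallowingTime_of_far hW hM hδ hδt hfar).2 t le_rfl).2
    rw [hquot] at h
    linarith
  · rw [not_le] at hfar
    set w := map W t z with hw
    have hwH : w ∈ upperHalfPlaneSet := mapsTo_map hW t hz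
    have hwc : ‖w - c‖ < M + 4 * δ := by
      by_contra hcon
      rw [not_lt] at hcon
      have hfar' : M + 2 * δ ≤ ‖w - c‖ := by linarith
      have h := norm_invFunOn_map_sub_self_le hW hM hδ hδt hwH hfar'
      rw [invFunOn_map_eq hW hwH hz rfl, hquot] at h
      have h2 : ‖w - c‖ ≤ ‖z - c‖ + ‖z - w‖ := by
        have := norm_sub_le_norm_sub_add_norm_sub w z c
        linarith [norm_sub_rev w z]
      have h3 : Real.sqrt t ≤ δ := by rw [hδdef]; linarith
      linarith
    calc ‖w - z‖ ≤ ‖w - c‖ + ‖c - z‖ := norm_sub_le_norm_sub_add_norm_sub _ _ _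
      _ ≤ (M + 4 * δ) + (M + 2 * δ) := by rw [norm_sub_rev c z]; linarith
      _ = 2 * M + 12 * Real.sqrt t := by rw [hδdef]; ring
      _ ≤ 2 * M + 13 * Real.sqrt t := by linarith

/-! ### The tip corresponds to the driving point only -/

section Tip

variable (hW : Continuous W) (hW0 : W 0 = 0) (hγ : IsGeneratedByCurve W γ) (hs : IsSimpleTrace γ)
include hW hW0 hγ hs

omit hW hW0 in
/-- The tip `γ(t)` (`t > 0`) lies in every earlier domain `Hₛ`, `s < t`. [folklore] -/
theorem IsGeneratedByCurve.apply_mem_domain_of_lt {s t : ℝ≥0} (hst : s < t) : γ t ∈ domain W s := by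
  refine ⟨hs.2 t (lt_of_le_of_lt bot_le hst), fun h ↦ ?_⟩
  rw [hγ.hull_eq_image hs s] at h
  obtain ⟨s', hs', heq⟩ := h
  have := hs.1 heq
  rw [this] at hs'
  exact absurd hs'.2 (not_le.2 hst)

omit hW0 in
/-- **The tip is reached only from the driving point** ([LSW] proof of Lemma 6.2: "since
`β(1) = z₀`, we must have `w = W`. Otherwise, one easily gets a contradiction to
`z₀ ∈ K_T ∖ ⋃_{t<T} K_t`"): for a chain generated by a simple curve and `t > 0`, the
only real `v` with `f̄ₜ v = γ(t)` is `v = Wₜ`. Proof: let `wₙ → v` in `ℍₒ`, so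
`zₙ = fₜ wₙ → γ t`. For `s < t` write `gₜ = g^{(s)}_{t-s} ∘ gₛ` (flow cocycle); `gₛ zₙ → gₛ(γ t)`,
which lies in the hull of the increment chain `W(s + ·)` of duration `t - s`, within
`O(osc_{[s,t]} W + √(t-s))` of `Wₛ` (Lemma 4.13); and `g^{(s)}_{t-s}` moves every point of its
domain by at most the same order (`norm_map_sub_self_le_of_mem_domain`). Letting `n → ∞` and
then `s ↗ t` gives `v = Wₜ`. [cite: LawlerSchrammWerner2003Restriction, proof of Lemma 6.2] -/
theorem IsGeneratedByCurve.eq_driving_of_bdryInv_eq {t : ℝ≥0} (ht : 0 < t) {v : ℝ} (hv : bdryInv W t v = γ t) :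
    v = W t := by
  -- it suffices to bound `|v - W t|` by every `η > 0`
  suffices key : ∀ η : ℝ, 0 < η → |v - W t| ≤ η by
    by_contra hne
    have hpos : 0 < |v - W t| := abs_pos.2 (sub_ne_zero.2 hne)
    have := key (|v - W t| / 2) (by positivity)
    linarith
  intro η hη
  have ht' : (0 : ℝ) < t := ht
  set η' : ℝ := η / 22 with hη'
  have hη'pos : 0 < η' := by positivity
  -- a short final interval `[s, t]`, `t = s + u`, on which `W` oscillates little
  obtain ⟨θ, hθ, hθW⟩ := Metric.continuousAt_iff.1 (hW.continuousAt (x := t)) η' hη'pos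
  set ρ : ℝ := min ((t : ℝ) / 2) (min (θ / 2) (η' ^ 2)) with hρdef
  have hρpos : 0 < ρ := by positivity
  have hρt : ρ ≤ (t : ℝ) / 2 := min_le_left _ _
  have hρθ : ρ ≤ θ / 2 := (min_le_right _ _).trans (min_le_left _ _)
  have hρη : ρ ≤ η' ^ 2 := (min_le_right _ _).trans (min_le_right _ _)
  set u : ℝ≥0 := ⟨ρ, hρpos.le⟩ with hudef
  have hu0 : 0 < u := hρpos
  have hucoe : (u : ℝ) = ρ := rfl
  have hut : u ≤ t := by
    rw [← NNReal.coe_le_coe, hucoe]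
    linarith
  set s : ℝ≥0 := t - u with hsdef
  have hsu : s + u = t := tsub_add_cancel_of_le hut
  have hst : s < t := by
    rw [← hsu]
    exact lt_add_of_pos_right s hu0
  have hscoe : (s : ℝ) = t - ρ := by rw [hsdef, NNReal.coe_sub hut, hucoe]
  have hsqrt : Real.sqrt u ≤ η' := by
    rw [hucoe, ← Real.sqrt_sq hη'pos.le]
    exact Real.sqrt_le_sqrt hρη
  -- oscillation of `W` on `[s, t]`
  have hosc : ∀ τ : ℝ≥0, s ≤ τ → τ ≤ t → |W τ - W t| ≤ η' := by
    intro τ h1 h2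
    have hd : dist τ t < θ := by
      rw [NNReal.dist_eq]
      have h2' : (τ : ℝ) ≤ t := by exact_mod_cast h2
      have h1' : (s : ℝ) ≤ τ := by exact_mod_cast h1
      rw [abs_of_nonpos (by linarith), neg_sub]
      linarith [hscoe]
    exact (le_of_lt (hθW hd))
  -- the increment chain `V = W (s + ·)` of duration `u`
  set V : ℝ≥0 → ℝ := fun τ ↦ W (s + τ) with hVdef
  have hV : Continuous V := hW.comp (continuous_const.add continuous_id)
  have hMV : ∀ τ ∈ Icc (0 : ℝ) u, ‖(V τ.toNNReal : ℂ) - (W t : ℂ)‖ ≤ η' := by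
    intro τ hτ
    rw [← Complex.ofReal_sub, Complex.norm_real, Real.norm_eq_abs]
    have hτu : τ.toNNReal ≤ u := by
      rw [← NNReal.coe_le_coe, Real.coe_toNNReal _ hτ.1]
      exact hτ.2
    refine hosc _ le_self_add ?_
    rw [← hsu]
    exact add_le_add le_rfl hτu
  have hSV : ∀ τ : ℝ≥0, τ ≤ u → |V τ - V 0| ≤ 2 * η' := by
    intro τ hτ
    have h1 := hosc (s + τ) le_self_add (by rw [← hsu]; exact add_le_add le_rfl hτ)
    have h2 := hosc s le_rfl hst.le
    simp only [hVdef, add_zero]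
    rw [abs_le] at h1 h2 ⊢
    constructor <;> linarith [h1.1, h1.2, h2.1, h2.2]
  -- the tip `z₀ = γ t`, its image `ζ = gₛ z₀` in the increment hull, close to `W t`
  set z₀ : ℂ := γ t with hz₀
  have hz₀s : z₀ ∈ domain W s := hγ.apply_mem_domain_of_lt hs hst
  have hz₀t : z₀ ∈ hull W t := hγ.mem_hull_of_mem_image (hs.2 t ht) ⟨t, ⟨bot_le, le_rfl⟩, rfl⟩
  set ζ : ℂ := map W s z₀ with hζ
  have hζhull : ζ ∈ hull V u := by
    have h := (mem_hull_iff_map_mem_hull hW hz₀s hst.le).1 hz₀t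
    rwa [show t - s = u by rw [← hsu, add_tsub_cancel_left]] at h
  have hζW : ‖ζ - (W t : ℂ)‖ ≤ 3 * η' + 4 * Real.sqrt u := by
    have h1 := norm_sub_driving_le_of_mem_hull hV hSV hζhull
    simp only [hVdef, add_zero] at h1
    have h2 : ‖((W s : ℝ) : ℂ) - (W t : ℂ)‖ ≤ η' := by
      rw [← Complex.ofReal_sub, Complex.norm_real, Real.norm_eq_abs]
      exact hosc s le_rfl hst.le
    calc ‖ζ - (W t : ℂ)‖ ≤ ‖ζ - (W s : ℂ)‖ + ‖((W s : ℝ) : ℂ) - (W t : ℂ)‖ :=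
          norm_sub_le_norm_sub_add_norm_sub _ _ _
      _ ≤ (2 * η' + 4 * Real.sqrt u) + η' := add_le_add h1 h2
      _ = 3 * η' + 4 * Real.sqrt u := by ring
  -- the approach: `wₙ → v` in `ℍₒ`, `zₙ = fₜ wₙ → z₀`, `ξₙ = gₛ zₙ → ζ`, `wₙ = g^{(s)}_u ξₙ`
  haveI := neBot_nhdsWithin_ofReal v
  set F := loewnerInv W t with hFdef
  have hFlim : Tendsto F (𝓝[upperHalfPlaneSet] (v : ℂ)) (𝓝 z₀) := by
    have h := hγ.tendsto_bdryInv hW t (z := (v : ℂ)) (by simp)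
    rwa [hv] at h
  have hFdom : ∀ᶠ w in 𝓝[upperHalfPlaneSet] (v : ℂ), F w ∈ domain W t := by
    filter_upwards [self_mem_nhdsWithin] with w hw
    exact (bijOn_invFunOn_map hW t).mapsTo hw
  have hξlim : Tendsto (fun w ↦ map W s (F w)) (𝓝[upperHalfPlaneSet] (v : ℂ)) (𝓝 ζ) :=
    ((continuousAt_map hW ((mem_domain_iff W s _).1 hz₀s).2).tendsto).comp hFlim
  -- on `ℍₒ` near `v`: `w = g^{(s)}_u (gₛ (fₜ w))` with `gₛ (fₜ w)` in the increment domain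
  have hcocycle : ∀ᶠ w in 𝓝[upperHalfPlaneSet] (v : ℂ),
      ‖w - map W s (F w)‖ ≤ 2 * η' + 13 * Real.sqrt u := by
    filter_upwards [hFdom, self_mem_nhdsWithin] with w hw hwH
    have hwt : ((s + u : ℝ≥0) : WithTop ℝ≥0) < swallowingTime W (F w) := by
      rw [hsu]
      exact ((mem_domain_iff W t _).1 hw).2
    obtain ⟨hlt, hmap⟩ := map_add hW hwt
    rw [hsu] at hmap
    have hid : map W t (F w) = w := (bijOn_map hW t).invOn_invFunOn.2 hwH
    have hξdom : map W s (F w) ∈ domain V u := by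
      refine (mem_domain_iff V u _).2 ⟨?_, hlt⟩
      exact mapsTo_map hW s (domain_antitone W hst.le hw)
    have h := norm_map_sub_self_le_of_mem_domain hV hMV hξdom
    rwa [← hmap, hid] at h
  -- pass to the limit `w → v`
  have hvζ : ‖(v : ℂ) - ζ‖ ≤ 2 * η' + 13 * Real.sqrt u := by
    have hlim : Tendsto (fun w ↦ ‖w - map W s (F w)‖) (𝓝[upperHalfPlaneSet] (v : ℂ))
        (𝓝 ‖(v : ℂ) - ζ‖) :=
      ((tendsto_nhdsWithin_of_tendsto_nhds tendsto_id).sub hξlim).norm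
    exact le_of_tendsto hlim hcocycle
  -- conclusion
  have hfin : ‖((v : ℝ) : ℂ) - (W t : ℂ)‖ ≤ 5 * η' + 17 * Real.sqrt u := by
    calc ‖((v : ℝ) : ℂ) - (W t : ℂ)‖ ≤ ‖(v : ℂ) - ζ‖ + ‖ζ - (W t : ℂ)‖ :=
          norm_sub_le_norm_sub_add_norm_sub _ _ _
      _ ≤ (2 * η' + 13 * Real.sqrt u) + (3 * η' + 4 * Real.sqrt u) := add_le_add hvζ hζW
      _ = 5 * η' + 17 * Real.sqrt u := by ring
  rw [← Complex.ofReal_sub, Complex.norm_real, Real.norm_eq_abs] at hfin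
  calc |v - W t| ≤ 5 * η' + 17 * Real.sqrt u := hfin
    _ ≤ 5 * η' + 17 * η' := by linarith [hsqrt]
    _ = η := by rw [hη']; ring

end Tip

end Loewner

end Literature.Probability.RandomPlanarGeometry

end
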